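import Literature.Probability.RandomPlanarGeometry.HexSAWPolygonCellsLemmaP
import Literature.Probability.RandomPlanarGeometry.HexSAWPolygonCellsRun
import Literature.Probability.RandomPlanarGeometry.HexSAWPolygonCellsOmegaRec
import HarnessLib

/-!
# Cell calculus for honeycomb polygon surgery, XXIII: base data for the Madras–Slade bases EX (flip) and ER (roof) — the port invariant, the `+2`, the
# polygonality of the base image

Topic `Literature/Probability/RandomPlanarGeometry` (lane «pcv-sawmu», a-p4 g22; sequel of XIV `…CellsLemmaP` (`ReadyPort`, `readyPort_portX/portR`), VIII
`…CellsDiag` (`portX/portR_diag_gap`), XIII `…CellsRun` (`flipImage`, `roofImage`, `runLen`), XXII `…CellsOmegaRec` (`PortInv`), XIX `…CellsPolygonMoves`).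

For the two Madras–Slade bases of «OMEGA» this file supplies exactly the three inputs of XXII's THEOREM V:
* ★ `portInv_flipImage` — `PortInv ∅ B (flipImage B t) (portX t)` for a brick set `B` of class X (`L t ∈ B`, `t` its top);
* ★ `portInv_roofImage` — `PortInv (roofExc B t) B (roofImage B t) (portR t (runLen B t))` for class R (`LR t ∈ B`), where the exceptional host set
  `roofExc B t` is `{e_{k−1}}` (the last run hexagon) when `k = runLen B t ≥ 2` and `∅` otherwise;
* `ReadyPort.urIter_notMem`, `ReadyPort.clear_ray` (a ready port has a clear up-right ray: part IV's `card_contacts_rayCell_succ` in set form);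
* ★ `isPolygon_bdry_flipImage`, ★ `isPolygon_bdry_union_roof` / `isPolygon_bdry_roofImage` — the base images have polygonal boundaries when `B` has
  (the flip inserts `UL t` with contact arc `{LL, LR}`; the roof inserts `a_1, …, a_k` with arcs `{L, LL, LR}` / `{L, LL}`: part XIX).
(The `+2` laws are XIII's `perim_flipImage`, `perim_roofImage`.)

Sources: N. Madras, G. Slade, *The Self-Avoiding Walk* (1993), §3.2, Theorem 3.2.3 (3.2.3) and its proof pp. 64–65 [MadrasSlade1993]; I. Jensen, J. Phys.:
Conf. Ser. 42 (2006) 163 [Jensen2006HoneycombPolygons].  Label (lane): LANE INFRASTRUCTURE; nothing new in writing.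
-/

open Finset Literature.Probability.LatticeModels

namespace Literature.Probability.RandomPlanarGeometry.SAW

namespace HexCell

/-! ### A ready port has a clear up-right ray -/

/-- The ray above a ready port misses the image. [cite: MadrasSlade1993, §3.2 (proof of Theorem 3.2.3)] -/
theorem ReadyPort.urIter_notMem {C : Finset Cell} {p : Cell} (h : ReadyPort C p) (j : ℕ) : urIter p j ∉ C := by
  rcases Nat.eq_zero_or_pos j with rfl | hj
  · rw [urIter_zero]; exact h.notMem
  · intro hm
    rcases h.clear _ hm with h1 | ⟨h1, h2⟩
    · simp [urIter] at h1; omega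
    · simp [urIter] at h1 h2; omega

/-- No hexagon of the image touches the ray above a ready port (beyond the port's own single contact).
[cite: MadrasSlade1993, §3.2 (proof of Theorem 3.2.3)] -/
theorem ReadyPort.clear_ray {C : Finset Cell} {p : Cell} (h : ReadyPort C p) (j : ℕ) (hj : 1 ≤ j) (c : Cell) (hc : c ∈ C) :
    c ∉ nbrs (urIter p j) := by
  intro hn
  obtain ⟨x, y⟩ := p
  obtain ⟨u, v⟩ := c
  have hrow := h.clear _ hc
  have hul : (u, v) ≠ UL (x, y) := fun e => h.ul (e ▸ hc)
  have hr : (u, v) ≠ R (x, y) := fun e => h.r (e ▸ hc)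
  have hp : (u, v) ≠ (x, y) := fun e => h.notMem (e ▸ hc)
  simp only [mem_nbrs_iff, urIter, Prod.mk.injEq] at hn
  simp only [UL, R, ne_eq, Prod.mk.injEq] at hul hr hp
  simp only at hrow
  omega

/-! ### The flip (class X) -/

/-- ★ **Port invariant of the flip image** (no exceptional host). [cite: MadrasSlade1993, §3.2 (proof of Theorem 3.2.3)] -/
theorem portInv_flipImage {B : Finset Cell} {t : Cell} (hB : IsBrickSet B) (ht : IsLexmax B t) (hL : L t ∈ B) :
    PortInv ∅ B (flipImage B t) (portX t) := by
  have hport : ∀ {d}, IsHost B d → ReadyPort (flipImage B t) (portX t d) := fun hd => readyPort_portX hB ht hL hd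
  refine ⟨hB, ?_, ?_, ?_, ?_, ?_, ?_⟩
  · intro c hc
    rcases mem_insert.1 hc with rfl | hc
    · have := hB t ht.1; simp only [UL_fst, UL_snd]; rw [Int.even_iff] at this ⊢; omega
    · exact hB c hc
  · intro h hh _
    have := hB h hh.1
    by_cases e : h = t
    · subst e; rw [show portX h h = UR (UL h) by simp [portX]]; simp only [UR_fst, UR_snd, UL_fst, UL_snd]
      rw [Int.even_iff] at this ⊢; omega
    · rw [show portX t h = UR h by simp [portX, e]]; simp only [UR_fst, UR_snd]; rw [Int.even_iff] at this ⊢; omega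
  · intro h hh _ j; exact (hport hh).urIter_notMem j
  · intro h hh _; exact (hport hh).one
  · intro h hh _ j hj c hc; exact (hport hh).clear_ray j hj c hc
  · intro h h' hh _ hh' _ hne; exact portX_diag_gap hB ht hL hh hh' hne

/-- ★ **The flip image has a polygonal boundary** when `B` has: `UL t` is inserted with the contact arc `{LL, LR} = {L t, t}`.
[cite: MadrasSlade1993, §3.2, proof of Theorem 3.2.3 pp. 64–65] -/
theorem isPolygon_bdry_flipImage {B : Finset Cell} {t : Cell} (hB : IsBrickSet B) (ht : IsLexmax B t) (hL : L t ∈ B)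
    (hP : IsPolygon brickWallGraph (bdry B)) (h2 : 2 < perim B) : IsPolygon brickWallGraph (bdry (flipImage B t)) := by
  have hc : Even ((UL t).1 + (UL t).2) := by
    have := hB t ht.1; simp only [UL_fst, UL_snd]; rw [Int.even_iff] at this ⊢; omega
  refine isPolygon_bdry_insert hB hc ht.ul_notMem hP (a := 0) (m := 2) (by norm_num) (by norm_num) h2 ?_
  intro i hi
  obtain ⟨x, y⟩ := t
  have hlexL : ∀ c ∈ B, c.2 ≤ y := fun c hc => by rcases ht.2 c hc with h1 | ⟨h1, -⟩ <;> simp at h1 ⊢ <;> omega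
  interval_cases i
  · rw [nbrDir_eq_of_mod_eq (UL (x, y)) (show (0 + 0) % 6 = 0 % 6 by norm_num)]
    simp only [show nbrDir (UL (x, y)) 0 = LL (UL (x, y)) from rfl, Nat.zero_lt_two, iff_true]
    convert hL using 1; exact Prod.ext (by show x - 1 - 1 = x - 2; ring) (by show y + 1 - 1 = y; ring)
  · rw [nbrDir_eq_of_mod_eq (UL (x, y)) (show (0 + 1) % 6 = 1 % 6 by norm_num)]
    simp only [show nbrDir (UL (x, y)) 1 = LR (UL (x, y)) from rfl, Nat.one_lt_two, iff_true]
    convert ht.1 using 1; exact Prod.ext (by show x - 1 + 1 = x; ring) (by show y + 1 - 1 = y; ring)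
  · rw [nbrDir_eq_of_mod_eq (UL (x, y)) (show (0 + 2) % 6 = 2 % 6 by norm_num)]
    simp only [show nbrDir (UL (x, y)) 2 = R (UL (x, y)) from rfl, show ¬ (2 < 2) by norm_num, iff_false]
    exact fun hm => ht.ur_notMem (by convert hm using 1; exact Prod.ext (by show x + 1 = x - 1 + 2; ring) rfl)
  · rw [nbrDir_eq_of_mod_eq (UL (x, y)) (show (0 + 3) % 6 = 3 % 6 by norm_num)]
    simp only [show nbrDir (UL (x, y)) 3 = UR (UL (x, y)) from rfl, show ¬ (3 < 2) by norm_num, iff_false]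
    exact fun hm => by have := hlexL _ hm; simp at this
  · rw [nbrDir_eq_of_mod_eq (UL (x, y)) (show (0 + 4) % 6 = 4 % 6 by norm_num)]
    simp only [show nbrDir (UL (x, y)) 4 = UL (UL (x, y)) from rfl, show ¬ (4 < 2) by norm_num, iff_false]
    exact fun hm => by have := hlexL _ hm; simp at this
  · rw [nbrDir_eq_of_mod_eq (UL (x, y)) (show (0 + 5) % 6 = 5 % 6 by norm_num)]
    simp only [show nbrDir (UL (x, y)) 5 = L (UL (x, y)) from rfl, show ¬ (5 < 2) by norm_num, iff_false]
    exact fun hm => by have := hlexL _ hm; simp at this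

/-! ### The roof (class R) -/

/-- `R e_i = e_{i+1}` along the run. [cite: MadrasSlade1993, §3.2 (proof of Theorem 3.2.3)] -/
theorem r_runCell (t : Cell) (i : ℕ) : R (runCell t i) = runCell t (i + 1) :=
  Prod.ext (by simp only [R_fst, runCell_fst]; push_cast; ring) rfl

/-- `UL e_0 = t`. [cite: MadrasSlade1993, §3.2 (proof of Theorem 3.2.3)] -/
theorem ul_runCell_zero (t : Cell) : UL (runCell t 0) = t := by
  ext <;> simp

/-- **The exceptional host of a type-R base**: the last run hexagon `e_{k−1}` when `k ≥ 2` (its up-right spot is the last roof hexagon, so it has no port;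
it never carries a spike in an admissible polygon — the roof-end situation). [cite: MadrasSlade1993, §3.2 (proof of Theorem 3.2.3)] -/
noncomputable def roofExc (B : Finset Cell) (t : Cell) : Finset Cell :=
  if 2 ≤ runLen B t then {runCell t (runLen B t - 1)} else ∅

/-- Hosts other than the exceptional one avoid the whole run. [cite: MadrasSlade1993, §3.2 (proof of Theorem 3.2.3)] -/
theorem ne_runCell_of_isHost {B : Finset Cell} {t d : Cell} (htB : t ∈ B) (hd : IsHost B d) (hX : d ∉ roofExc B t) :
    ∀ i < runLen B t, d ≠ runCell t i := by
  intro i hi e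
  subst e
  by_cases hlast : i + 1 < runLen B t
  · exact hd.2.1 (by rw [r_runCell]; exact runCell_mem_of_lt_runLen hlast)
  · rcases Nat.lt_or_ge (runLen B t) 2 with hk | hk
    · have hi0 : i = 0 := by omega
      subst hi0
      exact hd.2.2.1 (by rw [ul_runCell_zero]; exact htB)
    · apply hX
      rw [roofExc, if_pos hk, show i = runLen B t - 1 by omega]
      exact mem_singleton_self _

/-- ★ **Port invariant of the roof image** (exceptional host: the last run hexagon when `k ≥ 2`). [cite: MadrasSlade1993, §3.2 (proof of Theorem 3.2.3)] -/
theorem portInv_roofImage {B : Finset Cell} {t : Cell} (hB : IsBrickSet B) (ht : IsLexmax B t) (hLR : LR t ∈ B) :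
    PortInv (roofExc B t) B (roofImage B t) (portR t (runLen B t)) := by
  have hk : 1 ≤ runLen B t := one_le_runLen_iff.2 hLR
  have hrun : ∀ i < runLen B t, runCell t i ∈ B := fun i hi => runCell_mem_of_lt_runLen hi
  have hend : runCell t (runLen B t) ∉ B := runCell_runLen_notMem B t
  have hport : ∀ {d}, IsHost B d → d ∉ roofExc B t → ReadyPort (roofImage B t) (portR t (runLen B t) d) := fun hd hX =>
    readyPort_portR hB ht hk hrun hend hd (ne_runCell_of_isHost ht.1 hd hX)
  have htb := hB t ht.1
  refine ⟨hB, ?_, ?_, ?_, ?_, ?_, ?_⟩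
  · intro c hc
    rcases mem_union.1 hc with hc | hc
    · exact hB c hc
    · obtain ⟨_i, -, rfl⟩ := mem_roof.1 hc
      simp only [roofCell_fst, roofCell_snd]; rw [Int.even_iff] at htb ⊢; omega
  · intro h hh _
    have := hB h hh.1
    by_cases e : h = t
    · subst e; rw [show portR h (runLen B h) h = UR (roofCell h (runLen B h - 1)) by simp [portR]]
      simp only [UR_fst, UR_snd, roofCell_fst, roofCell_snd]; rw [Int.even_iff] at this ⊢; omega
    · rw [show portR t (runLen B t) h = UR h by simp [portR, e]]; simp only [UR_fst, UR_snd]; rw [Int.even_iff] at this ⊢; omega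
  · intro h hh hX j; exact (hport hh hX).urIter_notMem j
  · intro h hh hX; exact (hport hh hX).one
  · intro h hh hX j hj c hc; exact (hport hh hX).clear_ray j hj c hc
  · intro h h' hh hX hh' hX' hne
    exact portR_diag_gap hB ht hk hrun hend hh hh' hne (ne_runCell_of_isHost ht.1 hh hX) (ne_runCell_of_isHost ht.1 hh' hX')

/-- ★ **Partial roofs keep the boundary a polygon**: inserting `a_{j+1} = roofCell t j` into `B ∪ roof t j` uses the contact arc `{L, LL, LR}` (`j+1 < k`) or
`{L, LL}` (`j+1 = k`). [cite: MadrasSlade1993, §3.2, proof of Theorem 3.2.3 pp. 64–65] -/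
theorem isPolygon_bdry_union_roof {B : Finset Cell} {t : Cell} (hB : IsBrickSet B) (ht : IsLexmax B t) {k : ℕ}
    (hrun : ∀ i < k, runCell t i ∈ B) (hend : runCell t k ∉ B) (hP : IsPolygon brickWallGraph (bdry B)) (h4 : 4 ≤ perim B) :
    ∀ j ≤ k, IsPolygon brickWallGraph (bdry (B ∪ roof t j)) := by
  classical
  intro j
  induction j with
  | zero => intro _; simpa [roof] using hP
  | succ j ih =>
    intro hjk
    have hW := ih (by omega)
    obtain ⟨x, y⟩ := t
    have hy : ∀ c ∈ B ∪ roof (x, y) j, c.2 ≤ y := by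
      intro c hc
      rcases mem_union.1 hc with hc | hc
      · rcases ht.2 c hc with h1 | ⟨h1, -⟩ <;> simp at h1 ⊢ <;> omega
      · obtain ⟨_i, -, rfl⟩ := mem_roof.1 hc; simp
    have hWb : IsBrickSet (B ∪ roof (x, y) j) := by
      intro c hc
      rcases mem_union.1 hc with hc | hc
      · exact hB c hc
      · obtain ⟨_i, -, rfl⟩ := mem_roof.1 hc
        have := hB _ ht.1; simp only [roofCell_fst, roofCell_snd]; rw [Int.even_iff] at this ⊢; omega
    have hc : Even ((roofCell (x, y) j).1 + (roofCell (x, y) j).2) := by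
      have := hB _ ht.1; simp only [roofCell_fst, roofCell_snd]; rw [Int.even_iff] at this ⊢; omega
    have hnot : roofCell (x, y) j ∉ B ∪ roof (x, y) j := by
      rw [mem_union, not_or]
      refine ⟨ht.roofCell_notMem j, fun hm => ?_⟩
      obtain ⟨i, hi, e⟩ := mem_roof.1 hm
      have := roofCell_injective (x, y) e; omega
    have hperim : perim (B ∪ roof (x, y) j) = perim B := perim_union_roof_of_lt ht hrun hend (by omega)
    rw [roof_succ, union_insert]
    -- the contact arc from direction 5 (`L`): L, LL always; LR iff `j + 1 < k`
    have hL : L (roofCell (x, y) j) ∈ B ∪ roof (x, y) j := by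
      rcases Nat.eq_zero_or_pos j with rfl | hj
      · exact mem_union_left _ (by convert ht.1 using 1; ext <;> simp)
      · refine mem_union_right _ (mem_roof.2 ⟨j - 1, by omega, ?_⟩)
        exact Prod.ext (by simp only [roofCell_fst, L_fst]; omega) (by simp)
    have hLL : LL (roofCell (x, y) j) ∈ B ∪ roof (x, y) j := by
      refine mem_union_left _ ?_
      convert hrun j (by omega) using 1; exact Prod.ext (by simp only [LL_fst, roofCell_fst, runCell_fst]; ring) (by simp)
    have hLR : LR (roofCell (x, y) j) ∈ B ∪ roof (x, y) j ↔ j + 1 < k := by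
      have e : LR (roofCell (x, y) j) = runCell (x, y) (j + 1) :=
        Prod.ext (by simp only [LR_fst, roofCell_fst, runCell_fst]; push_cast; ring) (by simp only [LR_snd, roofCell_snd, runCell_snd])
      rw [e, mem_union]
      constructor
      · rintro (h | h)
        · by_contra hjk'
          have : j + 1 = k := by omega
          rw [this] at h; exact hend h
        · obtain ⟨i, -, ei⟩ := mem_roof.1 h
          have := congrArg Prod.snd ei; simp at this; omega
      · intro h; exact Or.inl (hrun _ h)
    have hR : R (roofCell (x, y) j) ∉ B ∪ roof (x, y) j := by
      have e : R (roofCell (x, y) j) = roofCell (x, y) (j + 1) :=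
        Prod.ext (by simp only [R_fst, roofCell_fst]; push_cast; ring) (by simp)
      rw [e, mem_union, not_or]
      refine ⟨ht.roofCell_notMem _, fun hm => ?_⟩
      obtain ⟨i, hi, ei⟩ := mem_roof.1 hm
      have := roofCell_injective (x, y) ei; omega
    have hUR : UR (roofCell (x, y) j) ∉ B ∪ roof (x, y) j := fun hm => by have := hy _ hm; simp at this
    have hUL : UL (roofCell (x, y) j) ∉ B ∪ roof (x, y) j := fun hm => by have := hy _ hm; simp at this
    by_cases hjk' : j + 1 < k
    · refine isPolygon_bdry_insert hWb hc hnot hW (a := 5) (m := 3) (by norm_num) (by norm_num) (by omega) ?_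
      intro i hi
      interval_cases i
      · rw [nbrDir_eq_of_mod_eq _ (show (5 + 0) % 6 = 5 % 6 by norm_num), show nbrDir (roofCell (x, y) j) 5 = L _ from rfl]; simpa using hL
      · rw [nbrDir_eq_of_mod_eq _ (show (5 + 1) % 6 = 0 % 6 by norm_num), show nbrDir (roofCell (x, y) j) 0 = LL _ from rfl]; simpa using hLL
      · rw [nbrDir_eq_of_mod_eq _ (show (5 + 2) % 6 = 1 % 6 by norm_num), show nbrDir (roofCell (x, y) j) 1 = LR _ from rfl]; simpa using hLR.2 hjk'
      · rw [nbrDir_eq_of_mod_eq _ (show (5 + 3) % 6 = 2 % 6 by norm_num), show nbrDir (roofCell (x, y) j) 2 = R _ from rfl]; simpa using hR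
      · rw [nbrDir_eq_of_mod_eq _ (show (5 + 4) % 6 = 3 % 6 by norm_num), show nbrDir (roofCell (x, y) j) 3 = UR _ from rfl]; simpa using hUR
      · rw [nbrDir_eq_of_mod_eq _ (show (5 + 5) % 6 = 4 % 6 by norm_num), show nbrDir (roofCell (x, y) j) 4 = UL _ from rfl]; simpa using hUL
    · refine isPolygon_bdry_insert hWb hc hnot hW (a := 5) (m := 2) (by norm_num) (by norm_num) (by omega) ?_
      intro i hi
      interval_cases i
      · rw [nbrDir_eq_of_mod_eq _ (show (5 + 0) % 6 = 5 % 6 by norm_num), show nbrDir (roofCell (x, y) j) 5 = L _ from rfl]; simpa using hL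
      · rw [nbrDir_eq_of_mod_eq _ (show (5 + 1) % 6 = 0 % 6 by norm_num), show nbrDir (roofCell (x, y) j) 0 = LL _ from rfl]; simpa using hLL
      · rw [nbrDir_eq_of_mod_eq _ (show (5 + 2) % 6 = 1 % 6 by norm_num), show nbrDir (roofCell (x, y) j) 1 = LR _ from rfl]
        simpa using fun h => hjk' (hLR.1 h)
      · rw [nbrDir_eq_of_mod_eq _ (show (5 + 3) % 6 = 2 % 6 by norm_num), show nbrDir (roofCell (x, y) j) 2 = R _ from rfl]; simpa using hR
      · rw [nbrDir_eq_of_mod_eq _ (show (5 + 4) % 6 = 3 % 6 by norm_num), show nbrDir (roofCell (x, y) j) 3 = UR _ from rfl]; simpa using hUR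
      · rw [nbrDir_eq_of_mod_eq _ (show (5 + 5) % 6 = 4 % 6 by norm_num), show nbrDir (roofCell (x, y) j) 4 = UL _ from rfl]; simpa using hUL

/-- ★ **The roof image has a polygonal boundary** when `B` has. [cite: MadrasSlade1993, §3.2, proof of Theorem 3.2.3 pp. 64–65] -/
theorem isPolygon_bdry_roofImage {B : Finset Cell} {t : Cell} (hB : IsBrickSet B) (ht : IsLexmax B t)
    (hP : IsPolygon brickWallGraph (bdry B)) (h4 : 4 ≤ perim B) : IsPolygon brickWallGraph (bdry (roofImage B t)) :=
  isPolygon_bdry_union_roof hB ht (fun _ hi => runCell_mem_of_lt_runLen hi) (runCell_runLen_notMem B t) hP h4 _ le_rfl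

end HexCell

end Literature.Probability.RandomPlanarGeometry.SAW
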